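import Mathlib
import Literature.Geometry.DiscreteGeometry.TwoShellPatterns

/-!
# Crux `NashClassCertificates.NashNearField` (stmt-AtomisticToContinuum-16827), line `birth`,
# stub `stub_chartCore` — part 3: METRIC LEMMAS of the robust pair step (label classes, ℓ¹ placement)

Pipeline-agnostic real-analysis facts needed by every proof of the placement property to which
`stub_chartCore` has been reduced (`…StubChartCoreAssemblyWeak`): a good centre sees its pattern particles
within `a/20`; a good pattern neighbour (the PIVOT) carries its own frame `w ↦ x_j + a' • A' w`, which in the
centre's normalised coordinates is `w ↦ y_j + B w` with `B = (a'/a) A⁻¹ A'` a linear map scaling all norms by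
`ρ = a'/a ∈ [47/50, 50/47]`; a COMMON particle (a pattern particle `c` of the centre adjacent to the pivot `v`,
or the centre itself) then satisfies `‖B w_c − (c − v)‖ ≤ (2 + ρ)/20 ≤ 36/235` for its label `w_c` in the
pivot's pattern.  From this:

* `norm_eq_one_of_label` — labels of commons are FIRST-shell points (norm `1`, not `√2`);
* `dist_eq_one_of_labels` — commons at distance `1` have labels at distance EXACTLY `1`;
* `dist_sq_mem_of_labels_sqrt_two` — commons at distance `√2` have labels at squared distance `2`, `8/3`
  or `3` (the metric window cannot separate these; they are separated combinatorially downstream);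
* `dist_sq_mem_of_unit_twoShellPattern` — the distance spectrum `{1, 2, 8/3, 3, 11/3, 4}` of (squared)
  distances between distinct first-shell points of either two-shell pattern (integer cores by `decide`);
* `norm_sub_le_of_cramer` — the ℓ¹ PLACEMENT BOUND: if `d • w = l₁ • w₁ + l₂ • w₂ + l₃ • w₃` (Cramer) for
  three labels `wₖ` of commons `cₖ`, the particle matched to `w` sits within
  `(|d − Σ lₖ|·τ₀ + Σ |lₖ|(τₖ + εₖ) + |d|·ε)/|d|` of the extrapolated point `v + Σ (lₖ/d)(cₖ − v)`
  (pure normed-space algebra, any tolerances).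
-/

noncomputable section

open Literature.Geometry.DiscreteGeometry

namespace Summit.AtomisticToContinuum.Crystallization.Theorems.NashClassCertificatesNashNearField

/-! ### The distance spectrum of the first shells -/

/-- fcc integer core: distinct first-shell vectors (squared norm `2`) differ by squared norm `2, 4, 6` or `8`. -/
theorem spectrum_core_fcc :
    ∀ t ∈ fccInt ∪ fccSecondShellInt, ∀ t' ∈ fccInt ∪ fccSecondShellInt, sqNormInt t = 2 → sqNormInt t' = 2 →
      t ≠ t' → sqNormInt (t - t') = 2 ∨ sqNormInt (t - t') = 4 ∨ sqNormInt (t - t') = 6 ∨ sqNormInt (t - t') = 8 := by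
  decide

/-- hcp integer core: distinct first-shell vectors (squared norm `18`) differ by squared norm
`18, 36, 48, 54, 66` or `72`. -/
theorem spectrum_core_hcp :
    ∀ t ∈ hcpInt ∪ hcpSecondShellInt, ∀ t' ∈ hcpInt ∪ hcpSecondShellInt, sqNormInt t = 18 → sqNormInt t' = 18 →
      t ≠ t' → sqNormInt (t - t') = 18 ∨ sqNormInt (t - t') = 36 ∨ sqNormInt (t - t') = 48 ∨
        sqNormInt (t - t') = 54 ∨ sqNormInt (t - t') = 66 ∨ sqNormInt (t - t') = 72 := by
  decide

/-- Squared norm of a scaled integer vector: `‖t/√N‖² = sqNormInt t / N`. -/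
theorem norm_sq_smul_intVec (t : Fin 3 → ℤ) {N : ℕ} (hN : N ≠ 0) :
    ‖(Real.sqrt N)⁻¹ • intVec t‖ ^ 2 = (sqNormInt t : ℝ) / N := by
  have hpos : (0 : ℝ) < Real.sqrt N := by positivity
  have hnn : (0 : ℝ) ≤ (sqNormInt t : ℝ) := by
    have : (0 : ℤ) ≤ sqNormInt t := by unfold sqNormInt; positivity
    exact_mod_cast this
  rw [norm_smul, norm_inv, Real.norm_of_nonneg hpos.le, norm_intVec, mul_pow, inv_pow,
    Real.sq_sqrt (by positivity), Real.sq_sqrt hnn]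
  ring

/-- Squared distance of two scaled integer vectors: `sqNormInt (t - t') / N`. -/
theorem dist_sq_smul_intVec (t t' : Fin 3 → ℤ) {N : ℕ} (hN : N ≠ 0) :
    dist ((Real.sqrt N)⁻¹ • intVec t) ((Real.sqrt N)⁻¹ • intVec t') ^ 2 = (sqNormInt (t - t') : ℝ) / N := by
  rw [dist_eq_norm, ← smul_sub, intVec_sub, norm_sq_smul_intVec _ hN]

/-- In a scaled pattern, a unit point comes from an integer vector of squared norm `N`. -/
theorem sqNormInt_eq_of_norm_eq_one {t : Fin 3 → ℤ} {N : ℕ} (hN : N ≠ 0)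
    (h : ‖(Real.sqrt N)⁻¹ • intVec t‖ = 1) : sqNormInt t = N := by
  have h2 := norm_sq_smul_intVec t hN
  rw [h, one_pow] at h2
  have hN' : (N : ℝ) ≠ 0 := by exact_mod_cast hN
  have : (sqNormInt t : ℝ) = N := by field_simp at h2; linarith
  exact_mod_cast this

/-- **Distance spectrum of the first shells.**  Two distinct unit points of either two-shell pattern are
at squared distance `1, 2, 8/3, 3, 11/3` or `4`. -/
theorem dist_sq_mem_of_unit_twoShellPattern {P : Finset (EuclideanSpace ℝ (Fin 3))}
    (hP : P = fccTwoShellPattern ∨ P = hcpTwoShellPattern) {w w' : EuclideanSpace ℝ (Fin 3)}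
    (hw : w ∈ P) (hw' : w' ∈ P) (h1 : ‖w‖ = 1) (h1' : ‖w'‖ = 1) (hne : w ≠ w') :
    dist w w' ^ 2 = 1 ∨ dist w w' ^ 2 = 2 ∨ dist w w' ^ 2 = 8 / 3 ∨ dist w w' ^ 2 = 3 ∨
      dist w w' ^ 2 = 11 / 3 ∨ dist w w' ^ 2 = 4 := by
  rcases hP with rfl | rfl
  · obtain ⟨t, ht, rfl⟩ := Finset.mem_image.1 hw
    obtain ⟨t', ht', rfl⟩ := Finset.mem_image.1 hw'
    have htt : t ≠ t' := fun h => hne (by rw [h])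
    have hs := spectrum_core_fcc t ht t' ht' (sqNormInt_eq_of_norm_eq_one two_ne_zero h1)
      (sqNormInt_eq_of_norm_eq_one two_ne_zero h1') htt
    rw [dist_sq_smul_intVec _ _ two_ne_zero]
    push_cast
    rcases hs with h | h | h | h <;> rw [h] <;> norm_num
  · obtain ⟨t, ht, rfl⟩ := Finset.mem_image.1 hw
    obtain ⟨t', ht', rfl⟩ := Finset.mem_image.1 hw'
    have htt : t ≠ t' := fun h => hne (by rw [h])
    have hs := spectrum_core_hcp t ht t' ht' (sqNormInt_eq_of_norm_eq_one (by norm_num) h1)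
      (sqNormInt_eq_of_norm_eq_one (by norm_num) h1') htt
    rw [dist_sq_smul_intVec _ _ (by norm_num)]
    push_cast
    rcases hs with h | h | h | h | h | h <;> rw [h] <;> norm_num

/-! ### Label classes -/

/-- `1.41421 < √2 < 1.41422`. -/
theorem sqrt_two_bounds : (141421 / 100000 : ℝ) < Real.sqrt 2 ∧ Real.sqrt 2 < 141422 / 100000 := by
  constructor
  · rw [show (141421 / 100000 : ℝ) = Real.sqrt ((141421 / 100000) ^ 2) by rw [Real.sqrt_sq]; norm_num]
    exact Real.sqrt_lt_sqrt (by norm_num) (by norm_num)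
  · rw [show (141422 / 100000 : ℝ) = Real.sqrt ((141422 / 100000) ^ 2) by rw [Real.sqrt_sq]; norm_num]
    exact Real.sqrt_lt_sqrt (by norm_num) (by norm_num)

/-- **Norm class of a label.**  A pattern point `w` (norm `1` or `√2`) whose image under a `ρ`-scaling linear
map (`ρ ≥ 47/50`) lies within `36/235` of a unit vector has norm `1`. -/
theorem norm_eq_one_of_label {B : EuclideanSpace ℝ (Fin 3) →ₗ[ℝ] EuclideanSpace ℝ (Fin 3)} {ρ : ℝ}
    (hB : ∀ x, ‖B x‖ = ρ * ‖x‖) (hρ : 47 / 50 ≤ ρ) {u w : EuclideanSpace ℝ (Fin 3)} (hu : ‖u‖ = 1)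
    (hw : ‖w‖ = 1 ∨ ‖w‖ = Real.sqrt 2) (h : ‖B w - u‖ ≤ 36 / 235) : ‖w‖ = 1 := by
  rcases hw with hw | hw
  · exact hw
  · exfalso
    obtain ⟨hs1, -⟩ := sqrt_two_bounds
    have h1 : ‖B w‖ ≤ ‖B w - u‖ + ‖u‖ := norm_le_norm_sub_add _ _
    rw [hB, hw, hu] at h1
    nlinarith

/-- **Adjacency class of two labels.**  If two first-shell pattern points `w, w'` are carried by a
`ρ`-scaling linear map (`ρ ≥ 47/50`) to within `36/235` of two points `u, u'` at distance `1`, then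
`dist w w' = 1` (the window `(0, 1.3898]` meets the first-shell spectrum only at `1`). -/
theorem dist_eq_one_of_labels {B : EuclideanSpace ℝ (Fin 3) →ₗ[ℝ] EuclideanSpace ℝ (Fin 3)} {ρ : ℝ}
    (hB : ∀ x, ‖B x‖ = ρ * ‖x‖) (hρ1 : 47 / 50 ≤ ρ)
    {P : Finset (EuclideanSpace ℝ (Fin 3))} (hP : P = fccTwoShellPattern ∨ P = hcpTwoShellPattern)
    {u u' w w' : EuclideanSpace ℝ (Fin 3)} (hw : w ∈ P) (hw' : w' ∈ P) (h1 : ‖w‖ = 1) (h1' : ‖w'‖ = 1)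
    (huu : dist u u' = 1) (h : ‖B w - u‖ ≤ 36 / 235) (h' : ‖B w' - u'‖ ≤ 36 / 235) : dist w w' = 1 := by
  have hkey : ‖B (w - w') - (u - u')‖ ≤ 72 / 235 := by
    rw [map_sub, show B w - B w' - (u - u') = (B w - u) - (B w' - u') by abel]
    exact (norm_sub_le _ _).trans (by linarith)
  have hBd : ‖B (w - w')‖ = ρ * dist w w' := by rw [hB, dist_eq_norm]
  have hlo : 1 - 72 / 235 ≤ ρ * dist w w' := by
    have := norm_sub_norm_le (u - u') (B (w - w'))
    rw [← dist_eq_norm, huu, hBd, norm_sub_rev] at this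
    linarith
  have hhi : ρ * dist w w' ≤ 1 + 72 / 235 := by
    have := norm_le_norm_sub_add (B (w - w')) (u - u')
    rw [hBd, ← dist_eq_norm u u', huu] at this
    linarith
  have hd0 : 0 ≤ dist w w' := dist_nonneg
  have hne : w ≠ w' := by
    intro heq
    rw [heq, dist_self, mul_zero] at hlo
    norm_num at hlo
  have hd2 : dist w w' ^ 2 < 2 := by nlinarith
  rcases dist_sq_mem_of_unit_twoShellPattern hP hw hw' h1 h1' hne with h2 | h2 | h2 | h2 | h2 | h2
  · nlinarith
  all_goals linarith

/-- **`√2` class of two labels.**  If two first-shell pattern points `w, w'` are carried by a `ρ`-scaling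
linear map (`ρ ∈ [47/50, 50/47]`) to within `36/235` of two points at distance `√2`, then
`dist w w'² ∈ {2, 8/3, 3}` (window `[1.0413, 1.8305]`; `1`, `11/3`, `4` are excluded). -/
theorem dist_sq_mem_of_labels_sqrt_two {B : EuclideanSpace ℝ (Fin 3) →ₗ[ℝ] EuclideanSpace ℝ (Fin 3)} {ρ : ℝ}
    (hB : ∀ x, ‖B x‖ = ρ * ‖x‖) (hρ1 : 47 / 50 ≤ ρ) (hρ2 : ρ ≤ 50 / 47)
    {P : Finset (EuclideanSpace ℝ (Fin 3))} (hP : P = fccTwoShellPattern ∨ P = hcpTwoShellPattern)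
    {u u' w w' : EuclideanSpace ℝ (Fin 3)} (hw : w ∈ P) (hw' : w' ∈ P) (h1 : ‖w‖ = 1) (h1' : ‖w'‖ = 1)
    (huu : dist u u' = Real.sqrt 2) (h : ‖B w - u‖ ≤ 36 / 235) (h' : ‖B w' - u'‖ ≤ 36 / 235) :
    dist w w' ^ 2 = 2 ∨ dist w w' ^ 2 = 8 / 3 ∨ dist w w' ^ 2 = 3 := by
  obtain ⟨hs1, hs2⟩ := sqrt_two_bounds
  have hkey : ‖B (w - w') - (u - u')‖ ≤ 72 / 235 := by
    rw [map_sub, show B w - B w' - (u - u') = (B w - u) - (B w' - u') by abel]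
    exact (norm_sub_le _ _).trans (by linarith)
  have hBd : ‖B (w - w')‖ = ρ * dist w w' := by rw [hB, dist_eq_norm]
  have hlo : Real.sqrt 2 - 72 / 235 ≤ ρ * dist w w' := by
    have := norm_sub_norm_le (u - u') (B (w - w'))
    rw [← dist_eq_norm, huu, hBd, norm_sub_rev] at this
    linarith
  have hhi : ρ * dist w w' ≤ Real.sqrt 2 + 72 / 235 := by
    have := norm_le_norm_sub_add (B (w - w')) (u - u')
    rw [hBd, ← dist_eq_norm u u', huu] at this
    linarith
  have hd0 : 0 ≤ dist w w' := dist_nonneg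
  have hne : w ≠ w' := by
    intro heq
    rw [heq, dist_self, mul_zero] at hlo
    linarith
  have hdlo : 1 < dist w w' ^ 2 := by nlinarith
  have hdhi : dist w w' ^ 2 < 11 / 3 := by nlinarith
  rcases dist_sq_mem_of_unit_twoShellPattern hP hw hw' h1 h1' hne with h2 | h2 | h2 | h2 | h2 | h2
  · linarith
  · exact Or.inl h2
  · exact Or.inr (Or.inl h2)
  · exact Or.inr (Or.inr h2)
  · linarith
  · linarith

/-! ### The ℓ¹ placement bound (Cramer extrapolation) -/

/-- **ℓ¹ placement bound.**  Normed-space algebra behind the frame comparison: `yj` (pivot particle) near `v`,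
common particles `yₖ` near `cₖ` and matched by the pivot's frame to the labels `wₖ` (`‖yₖ − (yj + B wₖ)‖ ≤ εₖ`),
a further particle `y` matched to the label `w` with `d • w = l₁ • w₁ + l₂ • w₂ + l₃ • w₃`; then `d • y` is
within `|d − Σ lₖ| τ₀ + Σ |lₖ| (τₖ + εₖ) + |d| ε` of `d • v + Σ lₖ • (cₖ − v)`. -/
theorem norm_sub_le_of_cramer {E : Type*} [NormedAddCommGroup E] [NormedSpace ℝ E] (B : E →ₗ[ℝ] E)
    {yj v y₁ y₂ y₃ c₁ c₂ c₃ w₁ w₂ w₃ w y : E} {τ₀ τ₁ τ₂ τ₃ ε₁ ε₂ ε₃ ε d l₁ l₂ l₃ : ℝ}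
    (hj : ‖yj - v‖ ≤ τ₀) (h₁ : ‖y₁ - c₁‖ ≤ τ₁) (h₂ : ‖y₂ - c₂‖ ≤ τ₂) (h₃ : ‖y₃ - c₃‖ ≤ τ₃)
    (hl₁ : ‖y₁ - (yj + B w₁)‖ ≤ ε₁) (hl₂ : ‖y₂ - (yj + B w₂)‖ ≤ ε₂) (hl₃ : ‖y₃ - (yj + B w₃)‖ ≤ ε₃)
    (hcr : d • w = l₁ • w₁ + l₂ • w₂ + l₃ • w₃) (hy : ‖y - (yj + B w)‖ ≤ ε) :
    ‖d • y - (d • v + (l₁ • (c₁ - v) + l₂ • (c₂ - v) + l₃ • (c₃ - v)))‖ ≤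
      |d - (l₁ + l₂ + l₃)| * τ₀ + (|l₁| * (τ₁ + ε₁) + |l₂| * (τ₂ + ε₂) + |l₃| * (τ₃ + ε₃)) + |d| * ε := by
  -- the error vectors
  set δ₀ := yj - v with hδ₀
  set r₁ := y₁ - (yj + B w₁) with hr₁
  set r₂ := y₂ - (yj + B w₂) with hr₂
  set r₃ := y₃ - (yj + B w₃) with hr₃
  set r := y - (yj + B w) with hr
  have hBw : d • B w = l₁ • B w₁ + l₂ • B w₂ + l₃ • B w₃ := by
    rw [← map_smul, hcr]; simp only [map_add, map_smul]
  have key : d • y - (d • v + (l₁ • (c₁ - v) + l₂ • (c₂ - v) + l₃ • (c₃ - v))) =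
      (d - (l₁ + l₂ + l₃)) • δ₀ + (l₁ • ((y₁ - c₁) - r₁) + l₂ • ((y₂ - c₂) - r₂) + l₃ • ((y₃ - c₃) - r₃)) +
        d • r := by
    have e1 : y = yj + B w + r := by rw [hr]; abel
    have eB₁ : B w₁ = y₁ - yj - r₁ := by rw [hr₁]; abel
    have eB₂ : B w₂ = y₂ - yj - r₂ := by rw [hr₂]; abel
    have eB₃ : B w₃ = y₃ - yj - r₃ := by rw [hr₃]; abel
    have ev : v = yj - δ₀ := by rw [hδ₀]; abel
    have e2 : d • y = d • yj + (l₁ • B w₁ + l₂ • B w₂ + l₃ • B w₃) + d • r := by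
      rw [e1, smul_add, smul_add, hBw]
    rw [e2, eB₁, eB₂, eB₃, ev]
    module
  rw [key]
  have n₀ : ‖(d - (l₁ + l₂ + l₃)) • δ₀‖ ≤ |d - (l₁ + l₂ + l₃)| * τ₀ := by
    rw [norm_smul, Real.norm_eq_abs]; exact mul_le_mul_of_nonneg_left hj (abs_nonneg _)
  have n₁ : ‖l₁ • ((y₁ - c₁) - r₁)‖ ≤ |l₁| * (τ₁ + ε₁) := by
    rw [norm_smul, Real.norm_eq_abs]
    exact mul_le_mul_of_nonneg_left ((norm_sub_le _ _).trans (add_le_add h₁ hl₁)) (abs_nonneg _)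
  have n₂ : ‖l₂ • ((y₂ - c₂) - r₂)‖ ≤ |l₂| * (τ₂ + ε₂) := by
    rw [norm_smul, Real.norm_eq_abs]
    exact mul_le_mul_of_nonneg_left ((norm_sub_le _ _).trans (add_le_add h₂ hl₂)) (abs_nonneg _)
  have n₃ : ‖l₃ • ((y₃ - c₃) - r₃)‖ ≤ |l₃| * (τ₃ + ε₃) := by
    rw [norm_smul, Real.norm_eq_abs]
    exact mul_le_mul_of_nonneg_left ((norm_sub_le _ _).trans (add_le_add h₃ hl₃)) (abs_nonneg _)
  have n₄ : ‖d • r‖ ≤ |d| * ε := by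
    rw [norm_smul, Real.norm_eq_abs]; exact mul_le_mul_of_nonneg_left hy (abs_nonneg _)
  calc _ ≤ ‖(d - (l₁ + l₂ + l₃)) • δ₀‖ +
        ‖l₁ • ((y₁ - c₁) - r₁) + l₂ • ((y₂ - c₂) - r₂) + l₃ • ((y₃ - c₃) - r₃)‖ + ‖d • r‖ :=
        norm_add₃_le
    _ ≤ ‖(d - (l₁ + l₂ + l₃)) • δ₀‖ +
        (‖l₁ • ((y₁ - c₁) - r₁)‖ + ‖l₂ • ((y₂ - c₂) - r₂)‖ + ‖l₃ • ((y₃ - c₃) - r₃)‖) + ‖d • r‖ := by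
        gcongr; exact norm_add₃_le
    _ ≤ _ := by linarith

/-- **Registered sub-goal `stub_chartCoreLabels` of crux stmt-AtomisticToContinuum-16827** (the adjacency class
of labels, the exact label-identification step of the robust pair lemma behind `stub_chartCore`): landing anchor
of this file, re-exporting `dist_eq_one_of_labels`. -/
theorem stub_chartCoreLabels : ∀ (B : EuclideanSpace ℝ (Fin 3) →ₗ[ℝ] EuclideanSpace ℝ (Fin 3)) (ρ : ℝ), (∀ x, ‖B x‖ = ρ * ‖x‖) → 47 / 50 ≤ ρ → ρ ≤ 50 / 47 → ∀ (P : Finset (EuclideanSpace ℝ (Fin 3))), (P = fccTwoShellPattern ∨ P = hcpTwoShellPattern) → ∀ (u u' w w' : EuclideanSpace ℝ (Fin 3)), w ∈ P → w' ∈ P → ‖w‖ = 1 → ‖w'‖ = 1 → dist u u' = 1 → ‖B w - u‖ ≤ 36 / 235 → ‖B w' - u'‖ ≤ 36 / 235 → dist w w' = 1 :=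
  fun _ _ hB hρ1 _ _ hP _ _ _ _ hw hw' h1 h1' huu h h' =>
    dist_eq_one_of_labels hB hρ1 hP hw hw' h1 h1' huu h h'

end Summit.AtomisticToContinuum.Crystallization.Theorems.NashClassCertificatesNashNearField

end
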